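import Summits.RiemannHypothesis.RiemannHypothesis.Theses.PluckedString
import Literature.NumberTheory.LFunctions.ZetaScrewThm12Proofs
import HarnessLib

/-!
# Route `PluckedString` — `ScrewConverse` (support item stmt-RiemannHypothesis-2625), CLOSED by name

CALIBRATION direction RH ⇒ X (Suzuki 2023, Thm 1.2, easy half): under the Riemann hypothesis every real
quadratic form of Suzuki's kernel `G(t,u) = Ψ(t) + Ψ(u) − Ψ(t − u)` is non-negative on every finite real
configuration.  This is exactly the landed Literature theorem
`Literature.NumberTheory.LFunctions.ZetaScrewThm12.sum_sum_kernel_nonneg` (proved in the tree from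
Thm 1.1 (2) / the explicit formula), with `Ψ = zetaScrew` (the route states `Ψ` as the inlined `let`,
which is `zetaScrew` by `rfl`, `zetaScrew_def` / `zetaScrewKernel_def`) and `Summit.RiemannHypothesis`
definitionally Mathlib's `RiemannHypothesis` (`Summit.RiemannHypothesis_iff`).  Same shape as the sibling
closer `screwConverse_proof` of route IntegerScrew (which restricts to log-integer configurations).
LABEL: RH-CONDITIONAL calibration (an implication FROM RH); nothing here bears on the truth of RH.
-/

-- `Summit.RiemannHypothesis.RiemannHypothesis.…` duplicates `RiemannHypothesis` BY DESIGN (D-0017).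
set_option linter.dupNamespace false

namespace Summit.RiemannHypothesis.RiemannHypothesis.Theorems

open Literature.NumberTheory.LFunctions

/-- **`ScrewConverse`** (route `PluckedString`, item stmt-RiemannHypothesis-2625): the Riemann hypothesis
implies `0 ≤ ∑ᵢ ∑ⱼ (Ψ(tᵢ) + Ψ(tⱼ) − Ψ(tᵢ − tⱼ)) xᵢ xⱼ` for every finite real configuration `t, x`
(Suzuki 2023 Thm 1.2, necessity), by `ZetaScrewThm12.sum_sum_kernel_nonneg`. -/
theorem pluckedStringScrewConverse_proof :
    Summit.RiemannHypothesis.RiemannHypothesis.Theses.PluckedString.ScrewConverse :=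
  fun hRH _ t x => ZetaScrewThm12.sum_sum_kernel_nonneg hRH t x

end Summit.RiemannHypothesis.RiemannHypothesis.Theorems
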